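import Literature.AnabelianGeometry.AbsoluteAnabelian.OneParameterSubgroupsPSL2RLie
import Literature.Analysis.Matrix.RealExponentialScalarSquare
import Mathlib.Topology.Algebra.Group.OpenMapping
import Mathlib.Topology.Baire.LocallyCompactRegular
import Mathlib.Topology.Instances.AddCircle.Defs

/-!
# One-parameter subgroups of `PSL₂(ℝ)`, III: one-parameter subgroups are lines or circles
# ([AbsTopIII] Cor. 2.7 (d), PROOF-ONLY infrastructure)

Continuing part I towards the discharge of `OneParameterSubgroupsPSL2R`
([MochizukiAbsTopIII2015] Corollary 2.7 (d) p.59). In a COMMUTATIVE subgroup of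
`G = SL₂(ℝ)/{±1}` (e.g. the closure of the image of a continuous homomorphism `ℝ → G`) the
one-parameter groups of the preimage commute in `M₂(ℝ)` (`exp_smul_commute_of_comm`), hence have
commuting generators (`commute_of_exp_smul_commute`). A one-parameter subgroup `T = π(exp ℝX₀)`,
`X₀ ≠ 0` traceless, is, as a topological group, a LINE `ℝ` when `det X₀ ≤ 0`
(`exists_homeomorph_line`, for closed `T`, by the open mapping theorem for `σ`-compact groups) and a
CIRCLE `ℝ/pℤ`, `p = π/√(det X₀)`, when `det X₀ > 0` (`exists_homeomorph_addCircle`,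
compact-to-Hausdorff); the kernels of `t ↦ π(exp tX₀)` are computed from the closed forms of
`exp (tX₀)` (`mk_expHom_eq_one_iff_of_det_nonpos`, `mk_expHom_eq_one_iff_of_det_pos`).

Everything is a theorem (no definitions, no named facts). No side is taken on anything in
[IUTchIII]; this is classical Lie theory (Hall 2015 [Hall2015]) serving a cited reconstruction step
of [AbsTopIII] §2.
-/

noncomputable section

open NormedSpace Filter Topology Set

namespace Literature.AnabelianGeometry.AbsoluteAnabelian

namespace OneParameterSubgroupsPSL2R

open Matrix Literature.Analysis.Matrix

open scoped MatrixGroups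

open scoped Matrix.Norms.Operator

-- As in `Mathlib/Analysis/Normed/Algebra/MatrixExponential.lean` and the tree's `DetExp.lean`: the
-- scoped `L∞`-operator normed ring structure on matrices is only reducibly-defeq to the Pi
-- uniformity, so `CompleteSpace` and the analytic facts about `exp` need this setting.
set_option backward.isDefEq.respectTransparency false

/-! ### Commuting one-parameter groups have commuting generators -/

/-- If the one-parameter groups of `X` and `Y` commute, `e^{sX} e^{tY} = e^{tY} e^{sX}` for all
`s, t`, then `XY = YX` (differentiate at `s = 0`, then at `t = 0`; Hall 2015 Prop. 2.4).
[cite: Hall2015, Prop. 2.4 p.38; MochizukiAbsTopIII2015, Corollary 2.7 (d) p.59] -/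
theorem commute_of_exp_smul_commute {X Y : (Matrix (Fin 2) (Fin 2) ℝ)}
    (h : ∀ s t : ℝ, exp (s • X) * exp (t • Y) = exp (t • Y) * exp (s • X)) : X * Y = Y * X := by
  -- first derivative in `s` at `0`: `X e^{tY} = e^{tY} X`
  have h1 : ∀ t : ℝ, X * exp (t • Y) = exp (t • Y) * X := by
    intro t
    have hF : HasDerivAt (fun s : ℝ => exp (s • X) * exp (t • Y))
        (X * exp ((0 : ℝ) • X) * exp (t • Y)) 0 :=
      (hasDerivAt_exp_smul_const' X (0 : ℝ)).mul_const _
    have hG : HasDerivAt (fun s : ℝ => exp (t • Y) * exp (s • X))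
        (exp (t • Y) * (X * exp ((0 : ℝ) • X))) 0 :=
      (hasDerivAt_exp_smul_const' X (0 : ℝ)).const_mul _
    have hFG : (fun s : ℝ => exp (s • X) * exp (t • Y)) = fun s : ℝ => exp (t • Y) * exp (s • X) :=
      funext fun s => h s t
    rw [hFG] at hF
    have := hF.unique hG
    simpa [zero_smul, NormedSpace.exp_zero] using this
  have hF : HasDerivAt (fun t : ℝ => X * exp (t • Y)) (X * (Y * exp ((0 : ℝ) • Y))) 0 :=
    (hasDerivAt_exp_smul_const' Y (0 : ℝ)).const_mul _
  have hG : HasDerivAt (fun t : ℝ => exp (t • Y) * X) (Y * exp ((0 : ℝ) • Y) * X) 0 :=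
    (hasDerivAt_exp_smul_const' Y (0 : ℝ)).mul_const _
  have hFG : (fun t : ℝ => X * exp (t • Y)) = fun t : ℝ => exp (t • Y) * X := funext h1
  rw [hFG] at hF
  have := hF.unique hG
  simpa [zero_smul, NormedSpace.exp_zero] using this

/-- In a COMMUTATIVE subgroup `S ≤ SL₂(ℝ)/{±1}`, two one-parameter groups of `π⁻¹(S)` commute in
`M₂(ℝ)`: their commutator is `±1`-valued, continuous in `(s, t)` on the connected `ℝ²`, and `= 1`
at `(0, 0)`. [cite: MochizukiAbsTopIII2015, Corollary 2.7 (d) p.59] -/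
theorem exp_smul_commute_of_comm (S : Subgroup (SL(2, ℝ) ⧸ Subgroup.center SL(2, ℝ)))
    (hcomm : ∀ a ∈ S, ∀ b ∈ S, a * b = b * a) {X Y : Matrix (Fin 2) (Fin 2) ℝ}
    (hX : ∀ t : ℝ, ∃ g : SL(2, ℝ), (g : Matrix (Fin 2) (Fin 2) ℝ) = exp (t • X) ∧
      (g : SL(2, ℝ) ⧸ Subgroup.center SL(2, ℝ)) ∈ S)
    (hY : ∀ t : ℝ, ∃ g : SL(2, ℝ), (g : Matrix (Fin 2) (Fin 2) ℝ) = exp (t • Y) ∧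
      (g : SL(2, ℝ) ⧸ Subgroup.center SL(2, ℝ)) ∈ S)
    (s t : ℝ) :
    exp (s • X) * exp (t • Y) = exp (t • Y) * exp (s • X) := by
  -- at every `(s, t)` the two products agree up to sign
  have hsign : ∀ s t : ℝ, exp (s • X) * exp (t • Y) = exp (t • Y) * exp (s • X) ∨
      exp (s • X) * exp (t • Y) = -(exp (t • Y) * exp (s • X)) := by
    intro s t
    obtain ⟨g, hg, hgS⟩ := hX s
    obtain ⟨h, hh, hhS⟩ := hY t
    have hgh : ((g * h : SL(2, ℝ)) : SL(2, ℝ) ⧸ Subgroup.center SL(2, ℝ)) =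
        ((h * g : SL(2, ℝ)) : SL(2, ℝ) ⧸ Subgroup.center SL(2, ℝ)) := by
      simpa using hcomm _ hgS _ hhS
    rcases (mk_eq_mk_iff _ _).mp hgh with h1 | h1
    · left
      have := congrArg (fun k : SL(2, ℝ) => (k : Matrix (Fin 2) (Fin 2) ℝ)) h1
      simp only [Matrix.SpecialLinearGroup.coe_mul, hg, hh] at this
      exact this.symm
    · right
      have := congrArg (fun k : SL(2, ℝ) => (k : Matrix (Fin 2) (Fin 2) ℝ)) h1
      simp only [Matrix.SpecialLinearGroup.coe_mul, Matrix.SpecialLinearGroup.coe_neg, hg, hh]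
        at this
      -- `e^{tY} e^{sX} = -(e^{sX} e^{tY})`
      rw [this, neg_neg]
  -- the set where they agree is clopen in `ℝ × ℝ`
  let P : ℝ × ℝ → Matrix (Fin 2) (Fin 2) ℝ := fun q =>
    exp (q.1 • X) * exp (q.2 • Y) - exp (q.2 • Y) * exp (q.1 • X)
  let N : ℝ × ℝ → Matrix (Fin 2) (Fin 2) ℝ := fun q =>
    exp (q.1 • X) * exp (q.2 • Y) + exp (q.2 • Y) * exp (q.1 • X)
  have hPc : Continuous P := by
    have h1 : Continuous fun q : ℝ × ℝ => exp (q.1 • X) :=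
      NormedSpace.exp_continuous.comp (continuous_fst.smul continuous_const)
    have h2 : Continuous fun q : ℝ × ℝ => exp (q.2 • Y) :=
      NormedSpace.exp_continuous.comp (continuous_snd.smul continuous_const)
    exact (h1.mul h2).sub (h2.mul h1)
  have hNc : Continuous N := by
    have h1 : Continuous fun q : ℝ × ℝ => exp (q.1 • X) :=
      NormedSpace.exp_continuous.comp (continuous_fst.smul continuous_const)
    have h2 : Continuous fun q : ℝ × ℝ => exp (q.2 • Y) :=
      NormedSpace.exp_continuous.comp (continuous_snd.smul continuous_const)
    exact (h1.mul h2).add (h2.mul h1)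
  have hZ : P ⁻¹' {0} = (N ⁻¹' {0})ᶜ := by
    ext ⟨s', t'⟩
    simp only [Set.mem_preimage, Set.mem_singleton_iff, Set.mem_compl_iff, P, N]
    constructor
    · intro hP hN
      have hsum : (2 : ℝ) • (exp (s' • X) * exp (t' • Y)) = 0 := by
        rw [two_smul]
        have e1 := sub_eq_zero.mp hP
        calc exp (s' • X) * exp (t' • Y) + exp (s' • X) * exp (t' • Y)
            = exp (s' • X) * exp (t' • Y) + exp (t' • Y) * exp (s' • X) := by rw [e1]
          _ = 0 := hN
      have hprod : exp (s' • X) * exp (t' • Y) = 0 := by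
        have := congrArg (fun M : (Matrix (Fin 2) (Fin 2) ℝ) => (2 : ℝ)⁻¹ • M) hsum
        simpa [smul_smul] using this
      have hunit : IsUnit (exp (s' • X) * exp (t' • Y)) :=
        (NormedSpace.isUnit_exp _).mul (NormedSpace.isUnit_exp _)
      rw [hprod] at hunit
      exact not_isUnit_zero hunit
    · intro hN
      rcases hsign s' t' with h1 | h1
      · exact sub_eq_zero.mpr h1
      · exact absurd (by rw [h1]; simp) hN
  have hclopen : IsClopen (P ⁻¹' {0}) := by
    refine ⟨isClosed_singleton.preimage hPc, ?_⟩
    rw [hZ]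
    exact (isClosed_singleton.preimage hNc).isOpen_compl
  have h0 : ((0 : ℝ), (0 : ℝ)) ∈ P ⁻¹' {0} := by simp [P]
  have huniv : P ⁻¹' {0} = Set.univ := hclopen.eq_univ ⟨_, h0⟩
  have hst : (s, t) ∈ P ⁻¹' {0} := by rw [huniv]; exact Set.mem_univ _
  simpa [P, sub_eq_zero] using hst

/-! ### When does `π(exp tX)` equal `1`? -/

/-- For a NON-ELLIPTIC traceless `X ≠ 0` (`det X ≤ 0`) the one-parameter group `t ↦ π(exp tX)` of
`SL₂(ℝ)/{±1}` has trivial kernel: `π(exp tX) = 1` iff `t = 0` (`exp tX = ±1` only at `t = 0`).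
[cite: Hall2015, §2.6 Exercise 6 (2.12) p.47; MochizukiAbsTopIII2015, Corollary 2.7 (d) p.59] -/
theorem mk_expHom_eq_one_iff_of_det_nonpos (X : Matrix (Fin 2) (Fin 2) ℝ) (hX : X.trace = 0) (hX0 : X ≠ 0)
    (hdet : X.det ≤ 0) (φ : Multiplicative ℝ →* SL(2, ℝ))
    (hφ : ∀ t : ℝ, ((φ (Multiplicative.ofAdd t) : SL(2, ℝ)) : Matrix (Fin 2) (Fin 2) ℝ) = exp (t • X))
    (t : Multiplicative ℝ) : ((φ t : SL(2, ℝ)) : SL(2, ℝ) ⧸ Subgroup.center SL(2, ℝ)) = 1 ↔ t = 1 := by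
  rw [mk_eq_one_iff]
  have hmat : (φ t = 1 ∨ φ t = -1) ↔ (exp (t.toAdd • X) = 1 ∨ exp (t.toAdd • X) = -1) := by
    rw [← hφ t.toAdd, ofAdd_toAdd]
    constructor
    · rintro (h | h)
      · left; rw [h]; rfl
      · right; rw [h]; rfl
    · rintro (h | h)
      · left; exact Subtype.ext h
      · right; exact Subtype.ext (by simpa using h)
  rw [hmat, exp_smul_eq_one_or_neg_one_iff_of_det_nonpos X hX hX0 hdet t.toAdd]
  exact ⟨fun h => toAdd_eq_zero.mp h, fun h => by rw [h]; rfl⟩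

/-- For an ELLIPTIC traceless `X ≠ 0` (`det X > 0`) the one-parameter group `t ↦ π(exp tX)` of
`SL₂(ℝ)/{±1}` has kernel `pℤ`, `p = π/√(det X)`: `π(exp uX) = 1` iff `u ∈ pℤ` (`exp uX = ±1` iff
`√(det X) u ∈ πℤ`). [cite: Hall2015, §2.6 Exercise 6 (2.12) p.47;
MochizukiAbsTopIII2015, Corollary 2.7 (d) p.59] -/
theorem mk_expHom_eq_one_iff_of_det_pos (X : Matrix (Fin 2) (Fin 2) ℝ) (hX : X.trace = 0) (hX0 : X ≠ 0)
    (hdet : 0 < X.det) (φ : Multiplicative ℝ →* SL(2, ℝ))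
    (hφ : ∀ t : ℝ, ((φ (Multiplicative.ofAdd t) : SL(2, ℝ)) : Matrix (Fin 2) (Fin 2) ℝ) = exp (t • X))
    (u : ℝ) :
    ((φ (Multiplicative.ofAdd u) : SL(2, ℝ)) : SL(2, ℝ) ⧸ Subgroup.center SL(2, ℝ)) = 1 ↔
      ∃ k : ℤ, u = k * (Real.pi / Real.sqrt X.det) := by
  set ω := Real.sqrt X.det with hω
  have hωpos : 0 < ω := Real.sqrt_pos.mpr hdet
  have hωp : ω * (Real.pi / ω) = Real.pi := by field_simp
  rw [mk_eq_one_iff]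
  have hmat : ((φ (Multiplicative.ofAdd u) = 1 ∨ φ (Multiplicative.ofAdd u) = -1) ↔
      (exp (u • X) = 1 ∨ exp (u • X) = -1)) := by
    rw [← hφ u]
    constructor
    · rintro (h | h)
      · left; rw [h]; rfl
      · right; rw [h]; rfl
    · rintro (h | h)
      · left; exact Subtype.ext h
      · right; exact Subtype.ext (by simpa using h)
  rw [hmat, exp_smul_eq_one_or_neg_one_iff_of_det_pos X hX hX0 hdet u]
  constructor
  · rintro ⟨k, hk⟩
    refine ⟨k, ?_⟩
    have : ω * u = ω * (k * (Real.pi / ω)) := by rw [hk, mul_left_comm, hωp]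
    exact mul_left_cancel₀ hωpos.ne' this
  · rintro ⟨k, rfl⟩
    exact ⟨k, by rw [mul_left_comm, hωp]⟩

/-! ### Hyperbolic / parabolic one-parameter subgroups are lines -/

/-- **A closed one-parameter subgroup `T = π(exp ℝX)` with `det X ≤ 0` is a LINE**: `t ↦ π(exp tX)`
is a homeomorphic group isomorphism `ℝ ≅ T` (injective since `exp (tX) ≠ ±1` for `t ≠ 0`, open by
the open mapping theorem for the `σ`-compact group `ℝ` onto the Baire group `T`).
[cite: MochizukiAbsTopIII2015, Corollary 2.7 (d) p.59] -/
theorem exists_homeomorph_line (T : Subgroup (SL(2, ℝ) ⧸ Subgroup.center SL(2, ℝ)))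
    (hT : IsClosed (T : Set (SL(2, ℝ) ⧸ Subgroup.center SL(2, ℝ)))) (X : Matrix (Fin 2) (Fin 2) ℝ)
    (hX : X.trace = 0) (hX0 : X ≠ 0) (hdet : X.det ≤ 0) (φ : Multiplicative ℝ →* SL(2, ℝ))
    (hφc : Continuous φ)
    (hφ : ∀ t : ℝ, ((φ (Multiplicative.ofAdd t) : SL(2, ℝ)) : Matrix (Fin 2) (Fin 2) ℝ) = exp (t • X))
    (hrange : ((QuotientGroup.mk' (Subgroup.center SL(2, ℝ))).comp φ).range = T) :
    ∃ e : Multiplicative ℝ ≃ₜ T,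
      (∀ t, ((e t : T) : SL(2, ℝ) ⧸ Subgroup.center SL(2, ℝ)) =
        ((φ t : SL(2, ℝ)) : SL(2, ℝ) ⧸ Subgroup.center SL(2, ℝ))) ∧
      ∀ a b, e (a * b) = e a * e b := by
  haveI : IsClosed ((Subgroup.center SL(2, ℝ) : Subgroup SL(2, ℝ)) : Set SL(2, ℝ)) := isClosed_center
  haveI : LocallyCompactSpace SL(2, ℝ) := locallyCompactSpace_SL2
  haveI : LocallyCompactSpace T := hT.locallyCompactSpace
  haveI : SigmaCompactSpace (Multiplicative ℝ) := inferInstanceAs (SigmaCompactSpace ℝ)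
  let ψ₀ : Multiplicative ℝ →* (SL(2, ℝ) ⧸ Subgroup.center SL(2, ℝ)) :=
    (QuotientGroup.mk' (Subgroup.center SL(2, ℝ))).comp φ
  have hψ₀T : ∀ t, ψ₀ t ∈ T := fun t => hrange ▸ ⟨t, rfl⟩
  let ψ : Multiplicative ℝ →* T := ψ₀.codRestrict T hψ₀T
  have hψc : Continuous ψ :=
    (QuotientGroup.continuous_mk.comp hφc).subtype_mk _
  have hψinj : Function.Injective ψ := by
    refine (injective_iff_map_eq_one ψ).mpr fun t ht => ?_
    have ht' : ((φ t : SL(2, ℝ)) : SL(2, ℝ) ⧸ Subgroup.center SL(2, ℝ)) = 1 := congrArg Subtype.val ht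
    exact (mk_expHom_eq_one_iff_of_det_nonpos X hX hX0 hdet φ hφ t).mp ht'
  have hψsurj : Function.Surjective ψ := by
    rintro ⟨y, hy⟩
    rw [← hrange] at hy
    obtain ⟨t, rfl⟩ := hy
    exact ⟨t, rfl⟩
  have hψopen : IsOpenMap ψ := MonoidHom.isOpenMap_of_sigmaCompact ψ hψsurj hψc
  let e : Multiplicative ℝ ≃ₜ T :=
    (Equiv.ofBijective ψ ⟨hψinj, hψsurj⟩).toHomeomorphOfContinuousOpen hψc hψopen
  exact ⟨e, fun t => rfl, fun a b => map_mul ψ a b⟩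

/-! ### Elliptic one-parameter subgroups are circles -/

/-- **A one-parameter subgroup `T = π(exp ℝX)` with `det X > 0` is a CIRCLE**: with
`p = π/√(det X)` the map `t ↦ π(exp tX)` is `p`-periodic and induces a homeomorphism
`ℝ/pℤ ≅ T` compatible with the group laws (continuous bijection from a compact space onto a
Hausdorff one). [cite: MochizukiAbsTopIII2015, Corollary 2.7 (d) p.59] -/
theorem exists_homeomorph_addCircle (T : Subgroup (SL(2, ℝ) ⧸ Subgroup.center SL(2, ℝ)))
    (X : Matrix (Fin 2) (Fin 2) ℝ) (hX : X.trace = 0)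
    (hX0 : X ≠ 0) (hdet : 0 < X.det) (φ : Multiplicative ℝ →* SL(2, ℝ)) (hφc : Continuous φ)
    (hφ : ∀ t : ℝ, ((φ (Multiplicative.ofAdd t) : SL(2, ℝ)) : Matrix (Fin 2) (Fin 2) ℝ) = exp (t • X))
    (hrange : ((QuotientGroup.mk' (Subgroup.center SL(2, ℝ))).comp φ).range = T) :
    ∃ e : AddCircle (Real.pi / Real.sqrt X.det) ≃ₜ T,
      (∀ t : ℝ, ((e (t : AddCircle (Real.pi / Real.sqrt X.det)) : T) : SL(2, ℝ) ⧸ Subgroup.center SL(2, ℝ)) =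
        ((φ (Multiplicative.ofAdd t) : SL(2, ℝ)) : SL(2, ℝ) ⧸ Subgroup.center SL(2, ℝ))) ∧
      ∀ a b, e (a + b) = e a * e b := by
  haveI : IsClosed ((Subgroup.center SL(2, ℝ) : Subgroup SL(2, ℝ)) : Set SL(2, ℝ)) := isClosed_center
  set ω := Real.sqrt X.det with hω
  have hωpos : 0 < ω := Real.sqrt_pos.mpr hdet
  set p : ℝ := Real.pi / ω with hp
  have hppos : 0 < p := div_pos Real.pi_pos hωpos
  haveI : Fact (0 < p) := ⟨hppos⟩
  have hωp : ω * p = Real.pi := by rw [hp]; field_simp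
  let ψ₀ : Multiplicative ℝ →* (SL(2, ℝ) ⧸ Subgroup.center SL(2, ℝ)) :=
    (QuotientGroup.mk' (Subgroup.center SL(2, ℝ))).comp φ
  have hψ₀T : ∀ t, ψ₀ t ∈ T := fun t => hrange ▸ ⟨t, rfl⟩
  -- the periodic map `q : ℝ → T`
  let q : ℝ → T := fun t => ⟨ψ₀ (Multiplicative.ofAdd t), hψ₀T _⟩
  have hqval : ∀ t, ((q t : T) : SL(2, ℝ) ⧸ Subgroup.center SL(2, ℝ)) =
      ((φ (Multiplicative.ofAdd t) : SL(2, ℝ)) : SL(2, ℝ) ⧸ Subgroup.center SL(2, ℝ)) := fun t => rfl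
  have hqc : Continuous q :=
    ((QuotientGroup.continuous_mk.comp hφc).comp continuous_ofAdd).subtype_mk _
  have hqadd : ∀ s t, q (s + t) = q s * q t := by
    intro s t
    apply Subtype.ext
    change ψ₀ (Multiplicative.ofAdd (s + t)) = ψ₀ (Multiplicative.ofAdd s) * ψ₀ (Multiplicative.ofAdd t)
    rw [ofAdd_add, map_mul]
  -- `q (s) = q (t)` iff `s - t ∈ pℤ`
  have hker : ∀ u : ℝ, ((φ (Multiplicative.ofAdd u) : SL(2, ℝ)) : SL(2, ℝ) ⧸ Subgroup.center SL(2, ℝ)) = 1 ↔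
      ∃ k : ℤ, u = k * p := fun u =>
    mk_expHom_eq_one_iff_of_det_pos X hX hX0 hdet φ hφ u
  have hqeq : ∀ s t : ℝ, q s = q t ↔ ∃ k : ℤ, t - s = k * p := by
    intro s t
    have : q t = q s * q (t - s) := by rw [← hqadd]; congr 1; ring
    rw [eq_comm, this, mul_eq_left, Subtype.ext_iff]
    exact hker (t - s)
  have hper : Function.Periodic q p := fun t => by
    rw [eq_comm, hqeq]; exact ⟨1, by simp⟩
  -- the induced map on the circle
  let e₀ : AddCircle p → T := hper.lift
  have he₀coe : ∀ t : ℝ, e₀ (t : AddCircle p) = q t := fun t => hper.lift_coe t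
  have he₀c : Continuous e₀ := by
    rw [(QuotientAddGroup.isQuotientMap_mk (N := AddSubgroup.zmultiples p)).continuous_iff]
    exact hqc
  have he₀inj : Function.Injective e₀ := by
    intro a b hab
    induction a using QuotientAddGroup.induction_on with
    | H s =>
      induction b using QuotientAddGroup.induction_on with
      | H t =>
        rw [he₀coe, he₀coe, hqeq] at hab
        obtain ⟨k, hk⟩ := hab
        rw [QuotientAddGroup.eq, AddSubgroup.mem_zmultiples_iff]
        exact ⟨k, by rw [zsmul_eq_mul]; linarith⟩
  have he₀surj : Function.Surjective e₀ := by
    rintro ⟨y, hy⟩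
    rw [← hrange] at hy
    obtain ⟨t, rfl⟩ := hy
    exact ⟨(t.toAdd : AddCircle p), by rw [he₀coe]; rfl⟩
  let e : AddCircle p ≃ₜ T :=
    Continuous.homeoOfEquivCompactToT2 (f := Equiv.ofBijective e₀ ⟨he₀inj, he₀surj⟩) he₀c
  refine ⟨e, fun t => ?_, fun a b => ?_⟩
  · change ((e₀ (t : AddCircle p) : T) : SL(2, ℝ) ⧸ Subgroup.center SL(2, ℝ)) = _
    rw [he₀coe]
    exact hqval t
  · change e₀ (a + b) = e₀ a * e₀ b
    induction a using QuotientAddGroup.induction_on with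
    | H s =>
      induction b using QuotientAddGroup.induction_on with
      | H t =>
        rw [← QuotientAddGroup.mk_add, he₀coe, he₀coe, he₀coe, hqadd]

end OneParameterSubgroupsPSL2R

end Literature.AnabelianGeometry.AbsoluteAnabelian

end
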